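import Literature.Analysis.FluidPDE.SolenoidalTruncation
import HarnessLib

/-!
# Localising the tests of a weak stationary Euler–Reynolds identity

Analysis/FluidPDE support file (everything proved; no definitions, no named facts). Two
bookkeeping lemmas used when a weak stationary Euler–Reynolds subsolution `(U, R)` on `ℝ³` is
planted in a periodic box and must be tested against the (periodic, hence NOT compactly supported)
lifts of torus test fields (`Summits/AnomalousDissipation`, point-sink scaffold; vocabulary of
De Lellis–Székelyhidi 2010, §2):

* `integral_eulerReynolds_eq_zero_of_eqOn_ball` — **the sink side.** Suppose `(U, R)` is at rest,
  `U = 0`, `R = c·Id`, outside the ball `|x| < r₁`, and satisfies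
  `∫ (⟪U, Dφ·U⟫ + Σᵢⱼ Rᵢⱼ (Dφ eⱼ)ᵢ) = 0` for every smooth divergence-free `φ` compactly supported
  in `ℝ³ ∖ {0}`. Then for every smooth divergence-free `w` on `ℝ³` vanishing on a neighbourhood of
  the origin — no support condition — `∫ (⟪U, Dw·U⟫ + Σᵢⱼ (Rᵢⱼ − c δᵢⱼ) (Dw eⱼ)ᵢ) = 0`. Proof:
  test with the tree's divergence-free truncation `solenoidalTruncation w r₁` (Poincaré homotopy
  corrector, `SolenoidalTruncation.lean`; Galdi 2011, §III.4), which agrees with `w` on `|x| < r₁`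
  and is compactly supported off the origin; on `|x| ≥ r₁` both integrands vanish, the constant
  stress pairing to `c div = 0` pointwise.
* `integral_cell_eq_zero_of_forall_test` — **the cell side.** If a triple `(W, S, f)` supported in
  a ball `B(p, ρ)` satisfies `∫ (⟪W, Dφ·W⟫ + Σᵢⱼ Sᵢⱼ (Dφ eⱼ)ᵢ + ⟪f, φ⟫) = 0` for every smooth
  compactly supported `φ`, then the same holds for every smooth `φ` (cut `φ` off by a bump equal to
  `1` on `B(p, ρ)`).

Coordinates: `(Dw eⱼ)ᵢ` with `eⱼ = EuclideanSpace.single j 1`; `div w = Σᵢ (Dw eᵢ)ᵢ`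
(a private copy of the tree's `sum_fderiv_apply_single_eq_divergence`).

## Mathlib / tree search

Tree: `solenoidalTruncation`, `contDiff_solenoidalTruncation`, `hasCompactSupport_solenoidalTruncation`,
`isDivFree_solenoidalTruncation`, `solenoidalTruncation_eventuallyEq` (`SolenoidalTruncation`),
`divergence_eq_sum_inner_fderiv` (`VectorCalculus`); Mathlib `ContDiffBump`. Nothing of this kind
found (`lean search 'localis|of_forall_test|solenoidalTruncation'` beyond the truncation itself).

## References

* G. P. Galdi, *An Introduction to the Mathematical Theory of the Navier–Stokes Equations*, 2nd ed.
  (2011), §III.4 (solenoidal truncation).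
* C. De Lellis, L. Székelyhidi Jr., Arch. Ration. Mech. Anal. 195 (2010), §2 (subsolutions).
-/

noncomputable section

open MeasureTheory Set Function Filter Metric TopologicalSpace
open scoped RealInnerProductSpace ContDiff Topology

namespace Literature.Analysis.FluidPDE

/-- In coordinates, `Σᵢ (Dw eᵢ)ᵢ = div w` (`eᵢ = EuclideanSpace.single i 1`); private copy of
the tree's `sum_fderiv_apply_single_eq_divergence` (`DifferentiableGaussGreen`, not imported to
keep the import graph light). [folklore] -/
private theorem sum_fderiv_apply_single_eq_divergence'
    (w : EuclideanSpace ℝ (Fin 3) → EuclideanSpace ℝ (Fin 3)) (x : EuclideanSpace ℝ (Fin 3)) :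
    ∑ i, fderiv ℝ w x (EuclideanSpace.single i 1) i = VectorCalculus.divergence w x := by
  rw [divergence_eq_sum_inner_fderiv (EuclideanSpace.basisFun (Fin 3) ℝ)]
  refine Finset.sum_congr rfl fun i _ => ?_
  rw [EuclideanSpace.basisFun_inner, EuclideanSpace.basisFun_apply]

/-- The constant stress `c·Id` pairs with `∇w` to `c div w`:
`Σᵢⱼ c δᵢⱼ (Dw eⱼ)ᵢ = c div w`. [folklore] -/
theorem sum_sum_ite_mul_fderiv_apply_eq
    (w : EuclideanSpace ℝ (Fin 3) → EuclideanSpace ℝ (Fin 3)) (x : EuclideanSpace ℝ (Fin 3))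
    (c : ℝ) :
    ∑ i, ∑ j, (if i = j then c else 0) * fderiv ℝ w x (EuclideanSpace.single j 1) i =
      c * VectorCalculus.divergence w x := by
  rw [← sum_fderiv_apply_single_eq_divergence', Finset.mul_sum]
  refine Finset.sum_congr rfl fun i _ => ?_
  simp only [ite_mul, zero_mul, Finset.sum_ite_eq, Finset.mem_univ, if_true]

/-! ### The sink side: tests vanishing near the origin -/

/-- **Localisation of the sink identity.** Let `(U, R)` be at rest (`U = 0`, `R = c·Id`) for
`|x| ≥ r₁` (`r₁ > 0`) and satisfy the weak stationary Euler–Reynolds identity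
`∫ (⟪U, Dφ·U⟫ + Σᵢⱼ Rᵢⱼ (Dφ eⱼ)ᵢ) = 0` for every smooth divergence-free `φ` compactly supported
in `ℝ³ ∖ {0}`. Then for every smooth divergence-free `w` on `ℝ³` vanishing on a ball around the
origin (not necessarily compactly supported),
`∫ (⟪U, Dw·U⟫ + Σᵢⱼ (Rᵢⱼ − c δᵢⱼ) (Dw eⱼ)ᵢ) = 0`: test with the divergence-free truncation
`solenoidalTruncation w r₁` (Galdi 2011, §III.4), which equals `w` on `|x| < r₁`; the two integrands
agree pointwise (on `|x| ≥ r₁` both vanish, `c·Id : ∇φ = c div φ = 0`). [folklore] -/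
theorem integral_eulerReynolds_eq_zero_of_eqOn_ball
    {U : EuclideanSpace ℝ (Fin 3) → EuclideanSpace ℝ (Fin 3)}
    {R : EuclideanSpace ℝ (Fin 3) → Fin 3 → Fin 3 → ℝ} {r₁ c : ℝ} (hr₁ : 0 < r₁)
    (hrest : ∀ x : EuclideanSpace ℝ (Fin 3), r₁ ≤ ‖x‖ →
      U x = 0 ∧ R x = fun i j => if i = j then c else 0)
    (hweak : ∀ φ : EuclideanSpace ℝ (Fin 3) → EuclideanSpace ℝ (Fin 3),
      FunctionSpaces.IsTestFunctionOn ⟨{x : EuclideanSpace ℝ (Fin 3) | x ≠ 0}, isOpen_ne⟩ φ →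
      (∀ x, VectorCalculus.divergence φ x = 0) →
      ∫ x, (⟪U x, fderiv ℝ φ x (U x)⟫ +
        ∑ i, ∑ j, R x i j * fderiv ℝ φ x (EuclideanSpace.single j 1) i) = 0)
    {w : EuclideanSpace ℝ (Fin 3) → EuclideanSpace ℝ (Fin 3)} (hw : ContDiff ℝ ∞ w)
    (hdiv : ∀ x, VectorCalculus.divergence w x = 0) {δ : ℝ} (hδ : 0 < δ)
    (h0 : ∀ x : EuclideanSpace ℝ (Fin 3), ‖x‖ < δ → w x = 0) :
    ∫ x, (⟪U x, fderiv ℝ w x (U x)⟫ +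
      ∑ i, ∑ j, (R x i j - if i = j then c else 0) *
        fderiv ℝ w x (EuclideanSpace.single j 1) i) = 0 := by
  set φ := solenoidalTruncation w r₁ with hφ
  have hφs : ContDiff ℝ ∞ φ := contDiff_solenoidalTruncation hw r₁
  have hφc : HasCompactSupport φ := hasCompactSupport_solenoidalTruncation hr₁
  have hφdiv : ∀ x, VectorCalculus.divergence φ x = 0 :=
    isDivFree_solenoidalTruncation finrank_euclideanSpace_fin (hw.of_le (by norm_cast)) hdiv r₁
  -- `φ = w` near every point of the open ball `|x| < r₁`
  have hloc : ∀ x : EuclideanSpace ℝ (Fin 3), ‖x‖ < r₁ → φ =ᶠ[𝓝 x] w := fun x hx =>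
    solenoidalTruncation_eventuallyEq hr₁ hx
  -- `φ` vanishes near the origin, hence is a test field on `ℝ³ ∖ {0}`
  have hφ0 : (0 : EuclideanSpace ℝ (Fin 3)) ∉ tsupport φ := by
    rw [notMem_tsupport_iff_eventuallyEq]
    have hw0 : w =ᶠ[𝓝 (0 : EuclideanSpace ℝ (Fin 3))] 0 := by
      filter_upwards [Metric.ball_mem_nhds (0 : EuclideanSpace ℝ (Fin 3)) hδ] with x hx
      exact h0 x (mem_ball_zero_iff.1 hx)
    exact (hloc 0 (by simpa using hr₁)).trans hw0
  have hφt : FunctionSpaces.IsTestFunctionOn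
      ⟨{x : EuclideanSpace ℝ (Fin 3) | x ≠ 0}, isOpen_ne⟩ φ :=
    ⟨hφs, hφc, fun x hx => by
      rintro rfl
      exact hφ0 hx⟩
  have key := hweak φ hφt hφdiv
  -- the two integrands agree pointwise
  have hpt : ∀ x, ⟪U x, fderiv ℝ w x (U x)⟫ +
      ∑ i, ∑ j, (R x i j - if i = j then c else 0) * fderiv ℝ w x (EuclideanSpace.single j 1) i =
      ⟪U x, fderiv ℝ φ x (U x)⟫ +
        ∑ i, ∑ j, R x i j * fderiv ℝ φ x (EuclideanSpace.single j 1) i := by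
    intro x
    by_cases hx : ‖x‖ < r₁
    · -- inside: `Dφ = Dw`, and the constant stress pairs to `c div w = 0`
      rw [(hloc x hx).fderiv_eq]
      simp_rw [sub_mul, Finset.sum_sub_distrib, sum_sum_ite_mul_fderiv_apply_eq, hdiv x]
      ring
    · -- outside: `U = 0`, `R = c·Id`, `c·Id : ∇φ = c div φ = 0`
      obtain ⟨hU, hR⟩ := hrest x (not_lt.1 hx)
      simp only [hU, inner_zero_left, zero_add, hR, sub_self, zero_mul, Finset.sum_const_zero]
      rw [sum_sum_ite_mul_fderiv_apply_eq, hφdiv x, mul_zero]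
  simp_rw [hpt]
  exact key

/-! ### The cell side: from compactly supported tests to all smooth tests -/

/-- **Localisation of the cell identity.** If `W`, `f` and a matrix field `S` are supported in a
ball `B(p, ρ)` and `∫ (⟪W, Dφ·W⟫ + Σᵢⱼ Sᵢⱼ (Dφ eⱼ)ᵢ + ⟪f, φ⟫) = 0` for every smooth compactly
supported `φ`, then the identity holds for every smooth `φ` whatsoever: replace `φ` by `χ φ` with a
bump `χ = 1` on `B(p, ρ)`; the integrands agree pointwise. [folklore] -/
theorem integral_cell_eq_zero_of_forall_test
    {W f : EuclideanSpace ℝ (Fin 3) → EuclideanSpace ℝ (Fin 3)}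
    {S : EuclideanSpace ℝ (Fin 3) → Fin 3 → Fin 3 → ℝ} {p : EuclideanSpace ℝ (Fin 3)} {ρ : ℝ}
    (hρ : 0 < ρ) (hWs : tsupport W ⊆ ball p ρ) (hfs : tsupport f ⊆ ball p ρ)
    (hSs : tsupport S ⊆ ball p ρ)
    (hcell : ∀ φ : EuclideanSpace ℝ (Fin 3) → EuclideanSpace ℝ (Fin 3), ContDiff ℝ ∞ φ →
      HasCompactSupport φ →
      ∫ x, (⟪W x, fderiv ℝ φ x (W x)⟫ +
        ∑ i, ∑ j, S x i j * fderiv ℝ φ x (EuclideanSpace.single j 1) i + ⟪f x, φ x⟫) = 0)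
    {φ : EuclideanSpace ℝ (Fin 3) → EuclideanSpace ℝ (Fin 3)} (hφ : ContDiff ℝ ∞ φ) :
    ∫ x, (⟪W x, fderiv ℝ φ x (W x)⟫ +
      ∑ i, ∑ j, S x i j * fderiv ℝ φ x (EuclideanSpace.single j 1) i + ⟪f x, φ x⟫) = 0 := by
  let χ : ContDiffBump p := ⟨ρ, 2 * ρ, hρ, by linarith⟩
  set ψ : EuclideanSpace ℝ (Fin 3) → EuclideanSpace ℝ (Fin 3) := fun x => χ x • φ x with hψ
  have hψs : ContDiff ℝ ∞ ψ := χ.contDiff.smul hφ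
  have hψc : HasCompactSupport ψ := χ.hasCompactSupport.smul_right
  have key := hcell ψ hψs hψc
  -- `ψ = φ` near every point of the open ball `B(p, ρ)`
  have hloc : ∀ x ∈ ball p ρ, ψ =ᶠ[𝓝 x] φ := fun x hx => by
    filter_upwards [isOpen_ball.mem_nhds hx] with y hy
    rw [hψ]
    simp only
    rw [χ.one_of_mem_closedBall (ball_subset_closedBall hy), one_smul]
  have hpt : ∀ x, ⟪W x, fderiv ℝ φ x (W x)⟫ +
      ∑ i, ∑ j, S x i j * fderiv ℝ φ x (EuclideanSpace.single j 1) i + ⟪f x, φ x⟫ =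
      ⟪W x, fderiv ℝ ψ x (W x)⟫ +
        ∑ i, ∑ j, S x i j * fderiv ℝ ψ x (EuclideanSpace.single j 1) i + ⟪f x, ψ x⟫ := by
    intro x
    by_cases hx : x ∈ ball p ρ
    · rw [(hloc x hx).fderiv_eq, (hloc x hx).eq_of_nhds]
    · have hW : W x = 0 := image_eq_zero_of_notMem_tsupport fun h => hx (hWs h)
      have hf : f x = 0 := image_eq_zero_of_notMem_tsupport fun h => hx (hfs h)
      have hS : S x = 0 := image_eq_zero_of_notMem_tsupport fun h => hx (hSs h)
      simp [hW, hf, hS]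
  simp_rw [hpt]
  exact key

end Literature.Analysis.FluidPDE
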